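import Literature.Analysis.FluidPDE.DEIJStageStep
import HarnessLib

/-!
# The Drivas–Elgindi–Iyer–Jeong cascade: parameters, stage recursion, the velocity field and the
# inviscid scalar, and their local structure in time

Proof-support file for the discharge of `deij_anomalous_dissipation_eventually`
(`TurbPassiveScalar`), continuing `DEIJShearStage`/`DEIJStageStep`: the construction of the
alternating smoothed-sawtooth shear flow of [cite: DrivasEtAl2022, §3.3, proof of Theorem 2] in
general dimension, as explicit definitions, together with its elementary structure. Everything is
proved; the growth estimates (`DEIJCascadeGrowth`) and the Hölder regularity
(`DEIJCascadeRegularity`) are in sibling files.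

* `DEIJ.CascadeData d`: the input — horizon `T > 0`, `m ≥ 1` (ratio `r = 2^m` of consecutive
  stage durations), base frequency `N₀` with `K_* = T(r-1)N₀ ≥ 16r`, coordinates `p₀ ≠ q₀`, a
  smooth scalar `g₀` with `‖∂_{p₀}g₀‖ ≠ 0`.
* parameters: corner widths `ε_j = 2^{-j}/256`, durations `t_j = T(r-1)/r^{j+1}` (summing to `T`),
  starting times `T_j = T(1 - r^{-j})`, frequencies `N_j = N₀(2r)^{j+1}`, slopes
  `K_j = t_j N_j = K_* 2^{j+1}`, alternating directions `(p_j, q_j)`, amplitudes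
  `A_j(t) = t_j ψ((t - T_j)/(t_j/2))` (`|A_j'| ≤ 2C_ψ`, at rest outside the first half of the stage).
* the recursion `DEIJ.CascadeData.state`: `g_{j+1} = g_j ∘ Φ_j`, where the profile of stage `j`,
  `DEIJ.CascadeData.prof`, is `y ↦ s_j S_{ε_j}(N_j y + ϑ_j)` with the datum-adapted phase `ϑ_j`
  of `DEIJ.exists_good_phase` and the sign `s_j` making the cross term of Lemma 3.2 favourable
  (`sign_mul_cross_nonpos`) — the datum-dependent choices of [cite: DrivasEtAl2022, §3.4, p. 12].
* the stage fields `G j t = g_j ∘ Φ_{A_j(t)}`, `U j t = A_j'(t) φ_j(x_{q_j}) e_{p_j}` (globally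
  smooth, `transport_G`: `∂_t G_j + ⟨U_j, ∇G_j⟩ = 0` exactly), the stage index `idx`, the glued
  velocity `u` and inviscid scalar `g`, and the globally smooth representatives `gN n` (the
  cascade stopped after stage `n`; `gN n t = g t` for `t < T_{n+1}`).
* local structure: on the open time pieces `piece k` the glued fields are single stage fields
  (`u_eq_of_mem_piece`, `g_eq_of_mem_piece`, `gN_eq_of_mem_piece`, `gN_eq_of_tail`); hence `u` is
  jointly smooth on `(-∞,T) × T^d` (`isSmoothSpaceTimeOn_u`), `gN n` on `ℝ × T^d`
  (`isSmoothSpaceTimeOn_gN`), and `transport_gN`: `∂_t (gN n) + ⟨u, ∇(gN n)⟩ = 0` for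
  `t < T_{n+1}`; `u` is divergence free and bounded by `2C_ψ` (`isDivFree_u`, `norm_u_le`).

## References

* [DrivasEtAl2022] T. D. Drivas, T. M. Elgindi, G. Iyer, I.-J. Jeong, *Anomalous dissipation in
  passive scalar transport*, Arch. Ration. Mech. Anal. 243 (2022), arXiv:1911.03271, §3.3–3.4.
-/

noncomputable section

open MeasureTheory TopologicalSpace Set Function Filter Topology UnitAddTorus
open scoped ENNReal NNReal InnerProductSpace ContDiff
open Literature.Analysis.FunctionSpaces.Torus
open Literature.Analysis.FunctionSpaces.Torus renaming partialDeriv → tPartialDeriv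

namespace Literature.Analysis.FluidPDE

namespace Torus

namespace DEIJ

variable {d : Type*} [Fintype d] [DecidableEq d]

omit [Fintype d] in
/-- The shear with amplitude `0` is the identity (any dimension). [folklore] -/
theorem shearMap_amp_zero' (p q : d) (P : ShearProfile) :
    shearMap p q (ShearStage.amp P 0) = id := by
  funext x
  rw [shearMap_apply, ShearStage.onCircle_amp, zero_mul]
  simp

/-! ## The data of a cascade and its numerical parameters -/

/-- **The data of a DEIJ cascade**: a horizon `T > 0`, an integer `m ≥ 1` (time ratio `r = 2^m`
between consecutive stages; `α(m+1) < m` makes the field `L¹_t C^α_x`), a base frequency `N₀`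
large enough that `K_* = T(r-1)N₀ ≥ 16r`, two distinct coordinates `p₀ ≠ q₀`, and a smooth
initial scalar `g₀` with a nonzero derivative in the direction `p₀`. [cite: DrivasEtAl2022, §3.3] -/
structure CascadeData (d : Type*) [Fintype d] [DecidableEq d] where
  /-- the time horizon -/
  T : ℝ
  T_pos : 0 < T
  /-- `r = 2^m` is the ratio of consecutive stage durations -/
  m : ℕ
  one_le_m : 1 ≤ m
  /-- base frequency -/
  N₀ : ℕ
  hN₀ : 16 * (2 : ℝ) ^ m ≤ T * (2 ^ m - 1) * N₀
  /-- displaced coordinate of the even stages -/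
  p₀ : d
  /-- driving coordinate of the even stages -/
  q₀ : d
  hpq : p₀ ≠ q₀
  /-- the initial scalar -/
  g₀ : UnitAddTorus d → ℝ
  smooth : IsSmooth g₀
  source_pos : 0 < ∫ x, tPartialDeriv p₀ g₀ x ^ 2

/-- A smooth scalar on `T^d` (the state of the cascade at the beginning of a stage). [folklore] -/
structure Stage (d : Type*) [Fintype d] [DecidableEq d] where
  /-- the scalar -/
  g : UnitAddTorus d → ℝ
  hg : IsSmooth g

namespace CascadeData

variable (D : CascadeData d)

/-- The ratio `r = 2^m ≥ 2` of consecutive stage durations. [folklore] -/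
def r : ℝ := 2 ^ D.m

/-- `two_le_r` (two le r). [folklore] -/
theorem two_le_r : 2 ≤ D.r := by
  have h : (2 : ℝ) ^ 1 ≤ 2 ^ D.m := pow_le_pow_right₀ (by norm_num) D.one_le_m
  simpa [r] using h

/-- `r_pos` (r pos). [folklore] -/
theorem r_pos : 0 < D.r := lt_of_lt_of_le two_pos D.two_le_r

/-- `one_le_r_sub_one` (one le r sub one). [folklore] -/
theorem one_le_r_sub_one : 1 ≤ D.r - 1 := by linarith [D.two_le_r]

/-- The corner width `ε_j = 2^{-j}/256` of stage `j`. [folklore] -/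
def ε (_D : CascadeData d) (j : ℕ) : ℝ := (2⁻¹) ^ j / 256

/-- `ε_pos` (ε pos). [folklore] -/
theorem ε_pos (j : ℕ) : 0 < D.ε j := by unfold ε; positivity

/-- `ε_le` (ε le). [folklore] -/
theorem ε_le (j : ℕ) : D.ε j ≤ 1 / 16 := by
  unfold ε
  have h : (2⁻¹ : ℝ) ^ j ≤ 1 := pow_le_one₀ (by norm_num) (by norm_num)
  linarith

/-- `ε_succ` (ε succ). [folklore] -/
theorem ε_succ (j : ℕ) : D.ε (j + 1) = D.ε j / 2 := by
  unfold ε; rw [pow_succ]; ring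

/-- `ε_zero` (ε zero). [folklore] -/
theorem ε_zero : D.ε 0 = 1 / 256 := by norm_num [ε]

/-- `8 ε_j ≤ 2^{-j}/32`. [folklore] -/
theorem eight_mul_ε (j : ℕ) : 8 * D.ε j = (2⁻¹) ^ j / 32 := by unfold ε; ring

/-- The duration `t_j = T(r-1)/r^{j+1}` of stage `j` (they sum to `T`). [folklore] -/
def dur (j : ℕ) : ℝ := D.T * (D.r - 1) / D.r ^ (j + 1)

/-- `dur_pos` (dur pos). [folklore] -/
theorem dur_pos (j : ℕ) : 0 < D.dur j := by
  unfold dur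
  exact div_pos (mul_pos D.T_pos (by linarith [D.two_le_r])) (pow_pos D.r_pos _)

/-- `dur_succ` (dur succ). [folklore] -/
theorem dur_succ (j : ℕ) : D.dur (j + 1) = D.dur j / D.r := by
  unfold dur; rw [pow_succ]; field_simp

/-- The starting time `T_j = T(1 - r^{-j})` of stage `j`. [folklore] -/
def Tst (j : ℕ) : ℝ := D.T * (1 - (D.r ^ j)⁻¹)

/-- `Tst_zero` (Tst zero). [folklore] -/
theorem Tst_zero : D.Tst 0 = 0 := by simp [Tst]

/-- `Tst_succ` (Tst succ). [folklore] -/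
theorem Tst_succ (j : ℕ) : D.Tst (j + 1) = D.Tst j + D.dur j := by
  have hr : D.r ≠ 0 := D.r_pos.ne'
  unfold Tst dur
  field_simp
  ring

/-- `Tst_lt_T` (Tst lt T). [folklore] -/
theorem Tst_lt_T (j : ℕ) : D.Tst j < D.T := by
  unfold Tst
  have h : 0 < (D.r ^ j)⁻¹ := inv_pos.2 (pow_pos D.r_pos _)
  nlinarith [D.T_pos]

/-- `Tst_nonneg` (Tst nonneg). [folklore] -/
theorem Tst_nonneg (j : ℕ) : 0 ≤ D.Tst j := by
  unfold Tst
  have h : (D.r ^ j)⁻¹ ≤ 1 := inv_le_one_of_one_le₀ (one_le_pow₀ (by linarith [D.two_le_r]))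
  nlinarith [D.T_pos]

/-- `Tst_lt_Tst_succ` (Tst lt Tst succ). [folklore] -/
theorem Tst_lt_Tst_succ (j : ℕ) : D.Tst j < D.Tst (j + 1) := by
  rw [Tst_succ]; linarith [D.dur_pos j]

/-- `Tst_strictMono` (Tst strictMono). [folklore] -/
theorem Tst_strictMono : StrictMono D.Tst := strictMono_nat_of_lt_succ D.Tst_lt_Tst_succ

/-- `Tst_mono` (Tst mono). [folklore] -/
theorem Tst_mono : Monotone D.Tst := D.Tst_strictMono.monotone

/-- `T - T_j = T r^{-j}`. [folklore] -/
theorem T_sub_Tst (j : ℕ) : D.T - D.Tst j = D.T * (D.r ^ j)⁻¹ := by unfold Tst; ring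

/-- The stages exhaust `[0, T)`. [folklore] -/
theorem exists_lt_Tst {t : ℝ} (ht : t < D.T) : ∃ j, t < D.Tst (j + 1) := by
  have h1 : 1 < D.r := by linarith [D.two_le_r]
  obtain ⟨j, hj⟩ := pow_unbounded_of_one_lt (D.T / (D.T - t)) h1
  refine ⟨j, ?_⟩
  have hpos : 0 < D.T - t := by linarith
  have hrj : 0 < D.r ^ j := pow_pos D.r_pos _
  rw [div_lt_iff₀ hpos] at hj
  have e : D.Tst (j + 1) = D.T - D.T * (D.r ^ (j + 1))⁻¹ := by unfold Tst; ring
  rw [e, pow_succ, mul_inv, ← div_eq_mul_inv]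
  have h2 : D.T * ((D.r ^ j)⁻¹ / D.r) < D.T * (D.r ^ j)⁻¹ := by
    refine mul_lt_mul_of_pos_left (div_lt_self (inv_pos.2 hrj) h1) D.T_pos
  have h3 : D.T * (D.r ^ j)⁻¹ < D.T - t := by
    rw [← div_eq_mul_inv, div_lt_iff₀ hrj]; linarith
  linarith

/-- The integer frequency `N_j = N₀ (2r)^{j+1}` of stage `j`. [folklore] -/
def Nf (j : ℕ) : ℕ := D.N₀ * (2 * 2 ^ D.m) ^ (j + 1)

/-- `cast_Nf` (cast Nf). [folklore] -/
theorem cast_Nf (j : ℕ) : (D.Nf j : ℝ) = D.N₀ * (2 * D.r) ^ (j + 1) := by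
  simp [Nf, r]

/-- `cast_Nf_succ` (cast Nf succ). [folklore] -/
theorem cast_Nf_succ (j : ℕ) : (D.Nf (j + 1) : ℝ) = 2 * D.r * D.Nf j := by
  rw [cast_Nf, cast_Nf, pow_succ]; ring

/-- The slope scale `K_* = T(r-1)N₀`. [folklore] -/
def Kstar : ℝ := D.T * (D.r - 1) * D.N₀

/-- `sixteen_r_le_Kstar` (sixteen r le Kstar). [folklore] -/
theorem sixteen_r_le_Kstar : 16 * D.r ≤ D.Kstar := by
  have h := D.hN₀; unfold Kstar r; exact h

/-- `Kstar_pos` (Kstar pos). [folklore] -/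
theorem Kstar_pos : 0 < D.Kstar := lt_of_lt_of_le (by linarith [D.two_le_r]) D.sixteen_r_le_Kstar

/-- `N₀_pos` (N₀ pos). [folklore] -/
theorem N₀_pos : 0 < (D.N₀ : ℝ) := by
  have h := D.Kstar_pos
  unfold Kstar at h
  have h2 : 0 < D.T * (D.r - 1) := mul_pos D.T_pos (by linarith [D.two_le_r])
  exact (mul_pos_iff_of_pos_left h2).mp h

/-- The maximal slope `K_j = t_j N_j = K_* 2^{j+1}` of stage `j`. [folklore] -/
def K (j : ℕ) : ℝ := D.dur j * D.Nf j

/-- `K_eq` (K eq). [folklore] -/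
theorem K_eq (j : ℕ) : D.K j = D.Kstar * 2 ^ (j + 1) := by
  have hr : D.r ≠ 0 := D.r_pos.ne'
  unfold K Kstar dur
  rw [cast_Nf, mul_pow]
  field_simp

/-- `K_pos` (K pos). [folklore] -/
theorem K_pos (j : ℕ) : 0 < D.K j := by rw [K_eq]; exact mul_pos D.Kstar_pos (by positivity)

/-- `K_j ≥ 16 r 2^{j+1}`. [folklore] -/
theorem le_K (j : ℕ) : 16 * D.r * 2 ^ (j + 1) ≤ D.K j := by
  rw [K_eq]; exact mul_le_mul_of_nonneg_right D.sixteen_r_le_Kstar (by positivity)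

/-- `K_j ≥ 64 · 2^j`. [folklore] -/
theorem le_K' (j : ℕ) : 64 * 2 ^ j ≤ D.K j := by
  have h := D.le_K j
  have h2 : (64 : ℝ) * 2 ^ j ≤ 16 * D.r * 2 ^ (j + 1) := by
    rw [pow_succ]; nlinarith [D.two_le_r, pow_pos (two_pos : (0 : ℝ) < 2) j]
  linarith

/-- `sixteen_le_K` (sixteen le K). [folklore] -/
theorem sixteen_le_K (j : ℕ) : 16 ≤ D.K j :=
  le_trans (by have := one_le_pow₀ (M₀ := ℝ) (a := 2) (n := j) (by norm_num); linarith) (D.le_K' j)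

/-! ## Directions -/

/-- The displaced coordinate of stage `j` (alternating). [folklore] -/
def pj (j : ℕ) : d := if Even j then D.p₀ else D.q₀

/-- The driving coordinate of stage `j` (alternating). [folklore] -/
def qj (j : ℕ) : d := if Even j then D.q₀ else D.p₀

/-- `pj_ne_qj` (pj ne qj). [folklore] -/
theorem pj_ne_qj (j : ℕ) : D.pj j ≠ D.qj j := by
  unfold pj qj; split_ifs <;> [exact D.hpq; exact D.hpq.symm]

/-- `pj_succ` (pj succ). [folklore] -/
theorem pj_succ (j : ℕ) : D.pj (j + 1) = D.qj j := by
  unfold pj qj; by_cases h : Even j <;> simp [h, Nat.even_add_one]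

/-- `qj_succ` (qj succ). [folklore] -/
theorem qj_succ (j : ℕ) : D.qj (j + 1) = D.pj j := by
  unfold pj qj; by_cases h : Even j <;> simp [h, Nat.even_add_one]

/-- `pj_zero` (pj zero). [folklore] -/
theorem pj_zero : D.pj 0 = D.p₀ := by simp [pj]

/-- `qj_zero` (qj zero). [folklore] -/
theorem qj_zero : D.qj 0 = D.q₀ := by simp [qj]

/-! ## The amplitude of a stage -/

/-- **The amplitude function of stage `j`**: `A_j(t) = t_j ψ((t - T_j)/(t_j/2))`, rising smoothly
from `0` (for `t ≤ T_j`) to `t_j` (for `t ≥ T_j + t_j/2`). [folklore] -/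
def A (j : ℕ) (t : ℝ) : ℝ := D.dur j * Real.smoothTransition ((t - D.Tst j) / (D.dur j / 2))

/-- `A_contDiff` (A contDiff). [folklore] -/
theorem A_contDiff (j : ℕ) : ContDiff ℝ ∞ (D.A j) :=
  contDiff_const.mul (Real.smoothTransition.contDiff.comp ((contDiff_id.sub contDiff_const).div_const _))

/-- `A_nonneg` (A nonneg). [folklore] -/
theorem A_nonneg (j : ℕ) (t : ℝ) : 0 ≤ D.A j t :=
  mul_nonneg (D.dur_pos j).le (Real.smoothTransition.nonneg _)

/-- `A_le` (A le). [folklore] -/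
theorem A_le (j : ℕ) (t : ℝ) : D.A j t ≤ D.dur j :=
  mul_le_of_le_one_right (D.dur_pos j).le (Real.smoothTransition.le_one _)

/-- `A_eq_zero` (A eq zero). [folklore] -/
theorem A_eq_zero {j : ℕ} {t : ℝ} (ht : t ≤ D.Tst j) : D.A j t = 0 := by
  unfold A
  rw [Real.smoothTransition.zero_of_nonpos
    (div_nonpos_of_nonpos_of_nonneg (by linarith) (by linarith [D.dur_pos j])), mul_zero]

/-- `A_eq_dur` (A eq dur). [folklore] -/
theorem A_eq_dur {j : ℕ} {t : ℝ} (ht : D.Tst j + D.dur j / 2 ≤ t) : D.A j t = D.dur j := by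
  unfold A
  rw [Real.smoothTransition.one_of_one_le, mul_one]
  rw [le_div_iff₀ (by linarith [D.dur_pos j])]; linarith

/-- The derivative of the amplitude. [folklore] -/
theorem hasDerivAt_A (j : ℕ) (t : ℝ) :
    HasDerivAt (D.A j) (2 * deriv Real.smoothTransition ((t - D.Tst j) / (D.dur j / 2))) t := by
  have hd : 0 < D.dur j := D.dur_pos j
  have h1 : HasDerivAt (fun t : ℝ => (t - D.Tst j) / (D.dur j / 2)) (1 / (D.dur j / 2)) t := by
    simpa using ((hasDerivAt_id t).sub_const (D.Tst j)).div_const (D.dur j / 2)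
  have h2 : HasDerivAt Real.smoothTransition (deriv Real.smoothTransition ((t - D.Tst j) / (D.dur j / 2)))
      ((t - D.Tst j) / (D.dur j / 2)) :=
    ((Real.smoothTransition.contDiff (n := 1)).contDiffAt.differentiableAt (by simp)).hasDerivAt
  have h3 := (h2.comp t h1).const_mul (D.dur j)
  refine HasDerivAt.congr_deriv h3 ?_
  field_simp

/-- `deriv_A` (deriv A). [folklore] -/
theorem deriv_A (j : ℕ) (t : ℝ) :
    deriv (D.A j) t = 2 * deriv Real.smoothTransition ((t - D.Tst j) / (D.dur j / 2)) :=
  (D.hasDerivAt_A j t).deriv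

/-- **Uniform speed bound**: `|A_j'| ≤ 2 C_ψ`. [folklore] -/
theorem abs_deriv_A_le (j : ℕ) (t : ℝ) : |deriv (D.A j) t| ≤ 2 * ShearCascade.Cψ1 := by
  rw [deriv_A, abs_mul, abs_two]
  exact mul_le_mul_of_nonneg_left (ShearCascade.Cψ1_spec.2 _) two_pos.le

/-- Before the stage the amplitude is at rest. [folklore] -/
theorem deriv_A_eq_zero_of_le {j : ℕ} {t : ℝ} (ht : t ≤ D.Tst j) : deriv (D.A j) t = 0 := by
  refine IsLocalMin.deriv_eq_zero ?_
  filter_upwards [] with s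
  rw [D.A_eq_zero ht]
  exact D.A_nonneg j s

/-- After the first half of the stage the amplitude is at rest. [folklore] -/
theorem deriv_A_eq_zero_of_ge {j : ℕ} {t : ℝ} (ht : D.Tst j + D.dur j / 2 ≤ t) : deriv (D.A j) t = 0 := by
  refine IsLocalMax.deriv_eq_zero ?_
  filter_upwards [] with s
  rw [D.A_eq_dur ht]
  exact D.A_le j s

/-- The speed is nonnegative (the transition is monotone). [folklore] -/
theorem deriv_A_nonneg (j : ℕ) (t : ℝ) : 0 ≤ deriv (D.A j) t := by
  have hmono : Monotone (D.A j) := fun a b hab => by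
    unfold A
    refine mul_le_mul_of_nonneg_left (Real.smoothTransition.monotone ?_) (D.dur_pos j).le
    exact div_le_div_of_nonneg_right (by linarith) (by linarith [D.dur_pos j])
  exact hmono.deriv_nonneg

/-! ## The recursion: phases, signs, profiles, states -/

/-- The phase of stage `j` started from the state `S` (a good phase of `exists_good_phase`). [folklore] -/
def phase (j : ℕ) (S : Stage d) : ℝ :=
  Classical.choose (exists_good_phase (D.ε_pos j) (D.ε_le j) S.hg (D.Nf j) (D.pj j) (D.qj j))

/-- `phase_spec` (phase spec). [folklore] -/
theorem phase_spec (j : ℕ) (S : Stage d) :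
    ∫ x, (1 - (slopeProfile (D.ε j) (D.ε_pos j) (D.ε_le j)).onCircle
        (D.Nf j • x (D.qj j) + (D.phase j S : UnitAddCircle)) ^ 2) * tPartialDeriv (D.pj j) S.g x ^ 2 ≤
        8 * D.ε j * ∫ x, tPartialDeriv (D.pj j) S.g x ^ 2 ∧
      ∫ x, (slopeProfile (D.ε j) (D.ε_pos j) (D.ε_le j)).D.onCircle
        (D.Nf j • x (D.qj j) + (D.phase j S : UnitAddCircle)) ^ 2 * ‖gradient S.g x‖ ^ 2 ≤
        32 * ShearCascade.Cψ1 ^ 2 / D.ε j * ∫ x, ‖gradient S.g x‖ ^ 2 :=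
  Classical.choose_spec (exists_good_phase (D.ε_pos j) (D.ε_le j) S.hg (D.Nf j) (D.pj j) (D.qj j))

/-- The cross term `X_j = ∫ w(N x_q + ϑ) ∂_q g ∂_p g` deciding the sign of stage `j`. [folklore] -/
def cross (j : ℕ) (S : Stage d) : ℝ :=
  ∫ x, (slopeProfile (D.ε j) (D.ε_pos j) (D.ε_le j)).onCircle
      (D.Nf j • x (D.qj j) + (D.phase j S : UnitAddCircle)) *
    (tPartialDeriv (D.qj j) S.g x * tPartialDeriv (D.pj j) S.g x)

/-- The sign of stage `j`: it makes the cross term of DEIJ Lemma 3.2 nonnegative. [folklore] -/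
def sign (j : ℕ) (S : Stage d) : ℝ := if D.cross j S ≤ 0 then 1 else -1

/-- `sign_spec` (sign spec). [folklore] -/
theorem sign_spec (j : ℕ) (S : Stage d) : D.sign j S = 1 ∨ D.sign j S = -1 := by
  unfold sign; split_ifs <;> simp

/-- `abs_sign` (abs sign). [folklore] -/
theorem abs_sign (j : ℕ) (S : Stage d) : |D.sign j S| = 1 := by
  rcases D.sign_spec j S with h | h <;> simp [h]

/-- `sign_mul_cross_nonpos` (sign mul cross nonpos). [folklore] -/
theorem sign_mul_cross_nonpos (j : ℕ) (S : Stage d) : D.sign j S * D.cross j S ≤ 0 := by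
  unfold sign; split_ifs with h
  · linarith
  · linarith [not_le.mp h]

/-- **The profile of stage `j`**: `y ↦ s_j S_{ε_j}(N_j y + ϑ_j)`. [folklore] -/
def prof (j : ℕ) (S : Stage d) : ShearProfile :=
  stageProfile (D.ε j) (D.ε_pos j) (D.ε_le j) (D.Nf j) (D.sign j S) (D.phase j S)

/-- `abs_prof_le` (abs prof le). [folklore] -/
theorem abs_prof_le (j : ℕ) (S : Stage d) (y : ℝ) : |D.prof j S y| ≤ 1 := by
  have h := abs_stageProfile_le (D.ε_pos j) (D.ε_le j) (D.Nf j) (D.sign j S) (D.phase j S) y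
  rwa [abs_sign] at h

/-- `abs_deriv_prof_le` (abs deriv prof le). [folklore] -/
theorem abs_deriv_prof_le (j : ℕ) (S : Stage d) (y : ℝ) : |deriv (D.prof j S) y| ≤ D.Nf j := by
  have h := abs_deriv_stageProfile_le (D.ε_pos j) (D.ε_le j) (D.Nf j) (D.sign j S) (D.phase j S) y
  rwa [abs_sign, one_mul] at h

/-- The state after stage `j`: the previous state sheared with the full amplitude `t_j`. [folklore] -/
def next (j : ℕ) (S : Stage d) : Stage d :=
  ⟨S.g ∘ shearMap (D.pj j) (D.qj j) (ShearStage.amp (D.prof j S) (D.dur j)), S.hg.comp_shearMap _ _ _⟩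

/-- **The states of the cascade**: `g_0 = g₀`, `g_{j+1} = g_j ∘ Φ_j`. [folklore] -/
def state : ℕ → Stage d
  | 0 => ⟨D.g₀, D.smooth⟩
  | j + 1 => D.next j (state j)

/-- `state_zero_g` (state zero g). [folklore] -/
theorem state_zero_g : (D.state 0).g = D.g₀ := rfl

/-- `state_succ_g` (state succ g). [folklore] -/
theorem state_succ_g (j : ℕ) :
    (D.state (j + 1)).g = (D.state j).g ∘ shearMap (D.pj j) (D.qj j) (ShearStage.amp (D.prof j (D.state j)) (D.dur j)) :=
  rfl

/-- The profile actually used in stage `j`. [folklore] -/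
def P (j : ℕ) : ShearProfile := D.prof j (D.state j)

/-! ## The fields of one stage and of the cascade -/

/-- **The inviscid scalar during stage `j`** (defined for all times):
`G_j(t) = g_j ∘ (x ↦ x - A_j(t) φ_j(x_{q_j}) e_{p_j})`. [folklore] -/
def G (j : ℕ) (t : ℝ) : UnitAddTorus d → ℝ :=
  (D.state j).g ∘ shearMap (D.pj j) (D.qj j) (ShearStage.amp (D.P j) (D.A j t))

/-- **The velocity during stage `j`** (defined for all times): `U_j(t) = A_j'(t) φ_j(x_{q_j}) e_{p_j}`. [folklore] -/
def U (j : ℕ) (t : ℝ) : UnitAddTorus d → EuclideanSpace ℝ d :=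
  drift (D.pj j) (D.qj j) (D.P j) (deriv (D.A j) t)

/-- `G_eq_moved` (G eq moved). [folklore] -/
theorem G_eq_moved (j : ℕ) : D.G j = moved (fun _ => (D.state j).g) (D.pj j) (D.qj j) (D.P j) (D.A j) := rfl

/-- `G_j` is jointly smooth on all of `ℝ × T^d`. [folklore] -/
theorem isSmoothSpaceTimeOn_G (j : ℕ) : FunctionSpaces.Torus.IsSmoothSpaceTimeOn univ (D.G j) := by
  rw [G_eq_moved]
  exact isSmoothSpaceTimeOn_moved (FunctionSpaces.Torus.isSmoothSpaceTimeOn_const (D.state j).hg univ) _ _ _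
    (D.A_contDiff j)

/-- `U_j` is jointly smooth on all of `ℝ × T^d`. [folklore] -/
theorem isSmoothSpaceTimeOn_U (j : ℕ) : FunctionSpaces.Torus.IsSmoothSpaceTimeOn univ (D.U j) :=
  isSmoothSpaceTimeOn_drift _ _ _ (D.A_contDiff j).deriv' univ

/-! ## Values of the stage fields at rest -/

/-- Before its stage, `G_j` is the state `g_j`. [folklore] -/
theorem G_eq_state {j : ℕ} {t : ℝ} (ht : t ≤ D.Tst j) : D.G j t = (D.state j).g := by
  unfold G; rw [D.A_eq_zero ht, shearMap_amp_zero']; rfl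

/-- After the first half of its stage, `G_j` is the next state `g_{j+1}`. [folklore] -/
theorem G_eq_state_succ {j : ℕ} {t : ℝ} (ht : D.Tst j + D.dur j / 2 ≤ t) : D.G j t = (D.state (j + 1)).g := by
  unfold G; rw [D.A_eq_dur ht]; rfl

/-- Before its stage, `U_j = 0`. [folklore] -/
theorem U_eq_zero_of_le {j : ℕ} {t : ℝ} (ht : t ≤ D.Tst j) : D.U j t = 0 := by
  unfold U; rw [D.deriv_A_eq_zero_of_le ht, drift_zero]

/-- After the first half of its stage, `U_j = 0`. [folklore] -/
theorem U_eq_zero_of_ge {j : ℕ} {t : ℝ} (ht : D.Tst j + D.dur j / 2 ≤ t) : D.U j t = 0 := by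
  unfold U; rw [D.deriv_A_eq_zero_of_ge ht, drift_zero]

/-- `Tst_add_half_lt` (Tst add half lt). [folklore] -/
theorem Tst_add_half_lt (j : ℕ) : D.Tst j + D.dur j / 2 < D.Tst (j + 1) := by
  rw [Tst_succ]; linarith [D.dur_pos j]

/-! ## The stage index and the glued fields -/

/-- **The stage index** `n(t)`: the `j` with `T_j ≤ t < T_{j+1}` (and `0` for `t < 0` or `t ≥ T`). [folklore] -/
def idx (t : ℝ) : ℕ := if h : t < D.T then Nat.find (D.exists_lt_Tst h) else 0

/-- `lt_Tst_idx_succ` (lt Tst idx succ). [folklore] -/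
theorem lt_Tst_idx_succ {t : ℝ} (ht : t < D.T) : t < D.Tst (D.idx t + 1) := by
  unfold idx; rw [dif_pos ht]; exact Nat.find_spec (D.exists_lt_Tst ht)

/-- `Tst_idx_le` (Tst idx le). [folklore] -/
theorem Tst_idx_le {t : ℝ} (ht : t < D.T) (h : D.idx t ≠ 0) : D.Tst (D.idx t) ≤ t := by
  unfold idx at h ⊢; rw [dif_pos ht] at h ⊢
  obtain ⟨k, hk⟩ := Nat.exists_eq_succ_of_ne_zero h
  have hmin := Nat.find_min (D.exists_lt_Tst ht) (m := k) (by rw [hk]; exact Nat.lt_succ_self k)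
  rw [hk]; exact not_lt.mp hmin

/-- `idx_eq` (idx eq). [folklore] -/
theorem idx_eq {t : ℝ} (ht : t < D.T) {j : ℕ} (h1 : j = 0 ∨ D.Tst j ≤ t) (h2 : t < D.Tst (j + 1)) : D.idx t = j := by
  unfold idx; rw [dif_pos ht, Nat.find_eq_iff]
  refine ⟨h2, fun n hn hlt => ?_⟩
  rcases h1 with h1 | h1
  · omega
  · have hmono : D.Tst (n + 1) ≤ D.Tst j := D.Tst_mono (by omega)
    linarith

/-- `n(t) ≤ j` as soon as `t < T_{j+1}`. [folklore] -/
theorem idx_le {t : ℝ} (ht : t < D.T) {j : ℕ} (h : t < D.Tst (j + 1)) : D.idx t ≤ j := by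
  by_contra hc
  push Not at hc
  have h0 : D.idx t ≠ 0 := by omega
  have h1 := D.Tst_idx_le ht h0
  have h2 : D.Tst (j + 1) ≤ D.Tst (D.idx t) := D.Tst_mono (by omega)
  linarith

/-- `j ≤ n(t)` as soon as `T_j ≤ t < T`. [folklore] -/
theorem le_idx {t : ℝ} (ht : t < D.T) {j : ℕ} (h : D.Tst j ≤ t) : j ≤ D.idx t := by
  by_contra hc
  push Not at hc
  have h1 := D.lt_Tst_idx_succ ht
  have h2 : D.Tst (D.idx t + 1) ≤ D.Tst j := D.Tst_mono (by omega)
  linarith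

/-- **The velocity field of the cascade.** [cite: DrivasEtAl2022, §3.3] -/
def u (t : ℝ) : UnitAddTorus d → EuclideanSpace ℝ d := D.U (D.idx t) t

/-- **The inviscid scalar of the cascade.** [cite: DrivasEtAl2022, §3.3] -/
def g (t : ℝ) : UnitAddTorus d → ℝ := D.G (D.idx t) t

/-- **The `n`-th global representative of the inviscid scalar**: the cascade stopped after stage
`n` (it agrees with `g` for `t < T_{n+1}` and is jointly smooth on all of `ℝ × T^d`). [folklore] -/
def gN (n : ℕ) (t : ℝ) : UnitAddTorus d → ℝ := if t < D.T then D.G (min (D.idx t) n) t else D.G n t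

/-- `gN_eq_g` (gN eq g). [folklore] -/
theorem gN_eq_g {n : ℕ} {t : ℝ} (ht : t < D.T) (h : D.idx t ≤ n) : D.gN n t = D.g t := by
  unfold gN g; rw [if_pos ht, min_eq_left h]

/-- `gN_eq_g_of_lt` (gN eq g of lt). [folklore] -/
theorem gN_eq_g_of_lt {n : ℕ} {t : ℝ} (h : t < D.Tst (n + 1)) : D.gN n t = D.g t :=
  D.gN_eq_g (h.trans (D.Tst_lt_T _)) (D.idx_le (h.trans (D.Tst_lt_T _)) h)

/-! ## Local structure in time -/

/-- The open time pieces on which the glued fields are single stage fields: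
`I₀ = (-∞, T_1)`, `I_{k+1} = (T_k + t_k/2, T_{k+2})`. [folklore] -/
def piece : ℕ → Set ℝ
  | 0 => Iio (D.Tst 1)
  | k + 1 => Ioo (D.Tst k + D.dur k / 2) (D.Tst (k + 2))

/-- `isOpen_piece` (isOpen piece). [folklore] -/
theorem isOpen_piece (k : ℕ) : IsOpen (D.piece k) := by
  cases k with
  | zero => exact isOpen_Iio
  | succ k => exact isOpen_Ioo

/-- `lt_T_of_mem_piece` (lt T of mem piece). [folklore] -/
theorem lt_T_of_mem_piece {k : ℕ} {t : ℝ} (ht : t ∈ D.piece k) : t < D.T := by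
  cases k with
  | zero => exact lt_trans ht (D.Tst_lt_T 1)
  | succ k => exact lt_trans ht.2 (D.Tst_lt_T _)

/-- Every time before `T` lies in the piece of its stage index. [folklore] -/
theorem mem_piece_idx {t : ℝ} (ht : t < D.T) : t ∈ D.piece (D.idx t) := by
  rcases h : D.idx t with _ | k
  · have := D.lt_Tst_idx_succ ht; rw [h] at this; exact this
  · refine ⟨?_, ?_⟩
    · have h1 := D.Tst_idx_le ht (by omega); rw [h] at h1
      linarith [D.Tst_add_half_lt k]
    · have := D.lt_Tst_idx_succ ht; rw [h] at this; exact this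

/-- On the piece `I_k` the stage index is `k` or `k - 1`. [folklore] -/
theorem idx_le_of_mem_piece {k : ℕ} {t : ℝ} (ht : t ∈ D.piece k) : D.idx t ≤ k := by
  cases k with
  | zero => exact D.idx_le (D.lt_T_of_mem_piece ht) ht
  | succ k => exact D.idx_le (D.lt_T_of_mem_piece ht) ht.2

/-- **On `I_k` the velocity is the stage field `U_k`.** [folklore] -/
theorem u_eq_of_mem_piece {k : ℕ} {t : ℝ} (ht : t ∈ D.piece k) : D.u t = D.U k t := by
  have hT := D.lt_T_of_mem_piece ht
  cases k with
  | zero => unfold u; rw [D.idx_eq hT (Or.inl rfl) ht]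
  | succ k =>
    obtain ⟨h1, h2⟩ := ht
    by_cases hlt : t < D.Tst (k + 1)
    · have hk : D.idx t = k := D.idx_eq hT (Or.inr (by linarith [D.dur_pos k])) hlt
      unfold u; rw [hk, D.U_eq_zero_of_ge h1.le, D.U_eq_zero_of_le hlt.le]
    · push Not at hlt
      unfold u; rw [D.idx_eq hT (Or.inr hlt) h2]

/-- **On `I_k` the inviscid scalar is the stage scalar `G_k`.** [folklore] -/
theorem g_eq_of_mem_piece {k : ℕ} {t : ℝ} (ht : t ∈ D.piece k) : D.g t = D.G k t := by
  have hT := D.lt_T_of_mem_piece ht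
  cases k with
  | zero => unfold g; rw [D.idx_eq hT (Or.inl rfl) ht]
  | succ k =>
    obtain ⟨h1, h2⟩ := ht
    by_cases hlt : t < D.Tst (k + 1)
    · have hk : D.idx t = k := D.idx_eq hT (Or.inr (by linarith [D.dur_pos k])) hlt
      unfold g; rw [hk, D.G_eq_state_succ h1.le, D.G_eq_state hlt.le]
    · push Not at hlt
      unfold g; rw [D.idx_eq hT (Or.inr hlt) h2]

/-- On `I_k`, `k ≤ n`, the `n`-th representative is `G_k`. [folklore] -/
theorem gN_eq_of_mem_piece {n k : ℕ} {t : ℝ} (ht : t ∈ D.piece k) (hk : k ≤ n) : D.gN n t = D.G k t := by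
  rw [D.gN_eq_g (D.lt_T_of_mem_piece ht) ((D.idx_le_of_mem_piece ht).trans hk), D.g_eq_of_mem_piece ht]

/-- On the tail `(T_n + t_n/2, ∞)` the `n`-th representative is `G_n`. [folklore] -/
theorem gN_eq_of_tail {n : ℕ} {t : ℝ} (ht : D.Tst n + D.dur n / 2 < t) : D.gN n t = D.G n t := by
  unfold gN
  split_ifs with hT
  · have h := D.le_idx hT (j := n) (by linarith [D.dur_pos n])
    rcases eq_or_lt_of_le h with h | h
    · rw [← h, min_self]
    · -- `idx t > n`: then `t ≥ T_{n+1}` and `G_{idx} = G_n`? No: here `min = n`.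
      rw [min_eq_right h.le]
  · rfl

/-! ## Smoothness of the glued fields -/

omit [DecidableEq d] in
/-- A space–time field that agrees near the time `t` with a globally smooth one is smooth at every
point over `t`. [folklore] -/
theorem contDiffAt_stLift_of_eqOn {V : Type*} [NormedAddCommGroup V] [NormedSpace ℝ V]
    {f F : ℝ → UnitAddTorus d → V} (hF : FunctionSpaces.Torus.IsSmoothSpaceTimeOn univ F) {O : Set ℝ} (hO : IsOpen O)
    (hfF : ∀ s ∈ O, f s = F s) {z : ℝ × EuclideanSpace ℝ d} (hz : z.1 ∈ O) :
    ContDiffAt ℝ ∞ (FunctionSpaces.Torus.stLift f) z := by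
  have hF' : ContDiff ℝ ∞ (FunctionSpaces.Torus.stLift F) := by
    have h := hF; unfold FunctionSpaces.Torus.IsSmoothSpaceTimeOn at h
    rwa [Set.univ_prod_univ, contDiffOn_univ] at h
  refine hF'.contDiffAt.congr_of_eventuallyEq ?_
  have hmem : Prod.fst ⁻¹' O ∈ 𝓝 z := (hO.preimage continuous_fst).mem_nhds hz
  filter_upwards [hmem] with w hw
  simp only [FunctionSpaces.Torus.stLift, hfF w.1 hw]

/-- **The velocity of the cascade is jointly smooth on `[0, T) × T^d`** (locally it is a single
stage field). [cite: DrivasEtAl2022, Theorem 2] -/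
theorem isSmoothSpaceTimeOn_u : FunctionSpaces.Torus.IsSmoothSpaceTimeOn (Ico 0 D.T) D.u := by
  intro z hz
  have ht : z.1 < D.T := (Set.mem_prod.1 hz).1.2
  exact (contDiffAt_stLift_of_eqOn (D.isSmoothSpaceTimeOn_U (D.idx z.1)) (D.isOpen_piece _)
    (fun s hs => D.u_eq_of_mem_piece hs) (D.mem_piece_idx ht)).contDiffWithinAt

/-- The velocity is even smooth on `(-∞, T) × T^d`. [folklore] -/
theorem isSmoothSpaceTimeOn_u_Iio : FunctionSpaces.Torus.IsSmoothSpaceTimeOn (Iio D.T) D.u := by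
  intro z hz
  have ht : z.1 < D.T := (Set.mem_prod.1 hz).1
  exact (contDiffAt_stLift_of_eqOn (D.isSmoothSpaceTimeOn_U (D.idx z.1)) (D.isOpen_piece _)
    (fun s hs => D.u_eq_of_mem_piece hs) (D.mem_piece_idx ht)).contDiffWithinAt

/-- The inviscid scalar is smooth on `(-∞, T) × T^d`. [folklore] -/
theorem isSmoothSpaceTimeOn_g_Iio : FunctionSpaces.Torus.IsSmoothSpaceTimeOn (Iio D.T) D.g := by
  intro z hz
  have ht : z.1 < D.T := (Set.mem_prod.1 hz).1
  exact (contDiffAt_stLift_of_eqOn (D.isSmoothSpaceTimeOn_G (D.idx z.1)) (D.isOpen_piece _)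
    (fun s hs => D.g_eq_of_mem_piece hs) (D.mem_piece_idx ht)).contDiffWithinAt

/-- **The representatives `gN n` are jointly smooth on all of `ℝ × T^d`.** [folklore] -/
theorem isSmoothSpaceTimeOn_gN (n : ℕ) : FunctionSpaces.Torus.IsSmoothSpaceTimeOn univ (D.gN n) := by
  intro z _
  by_cases ht : D.Tst n + D.dur n / 2 < z.1
  · exact (contDiffAt_stLift_of_eqOn (D.isSmoothSpaceTimeOn_G n) isOpen_Ioi
      (fun s hs => D.gN_eq_of_tail hs) ht).contDiffWithinAt
  · push Not at ht
    have hT : z.1 < D.T := lt_of_le_of_lt ht ((D.Tst_add_half_lt n).trans (D.Tst_lt_T _))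
    have hk : D.idx z.1 ≤ n := D.idx_le hT (lt_of_le_of_lt ht (D.Tst_add_half_lt n))
    exact (contDiffAt_stLift_of_eqOn (D.isSmoothSpaceTimeOn_G (D.idx z.1)) (D.isOpen_piece _)
      (fun s hs => D.gN_eq_of_mem_piece hs hk) (D.mem_piece_idx hT)).contDiffWithinAt

/-! ## The transport equation -/

/-- **The stage scalar is transported by the stage velocity** (exactly, at every point of
space–time). [cite: DrivasEtAl2022, §2.1, (2.1)–(2.3)] -/
theorem transport_G (j : ℕ) (t : ℝ) (x : UnitAddTorus d) :
    FunctionSpaces.Torus.timeDerivWithin univ (D.G j) t x + ⟪D.U j t x, gradient (D.G j t) x⟫_ℝ = 0 := by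
  rw [G_eq_moved]
  exact transport_moved_static (D.state j).hg (D.pj_ne_qj j) (D.P j) (D.A_contDiff j) t x

/-- **The representative `gN n` solves the transport equation with the cascade velocity up to
`T_{n+1}`.** [folklore] -/
theorem transport_gN (n : ℕ) {t : ℝ} (ht : t < D.Tst (n + 1)) (x : UnitAddTorus d) :
    FunctionSpaces.Torus.timeDerivWithin univ (D.gN n) t x + ⟪D.u t x, gradient (D.gN n t) x⟫_ℝ = 0 := by
  have hT : t < D.T := ht.trans (D.Tst_lt_T _)
  have hk : D.idx t ≤ n := D.idx_le hT ht
  set k := D.idx t with hkdef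
  have hmem : t ∈ D.piece k := D.mem_piece_idx hT
  have hev : ∀ᶠ τ in 𝓝 t, D.gN n τ = D.G k τ := by
    filter_upwards [(D.isOpen_piece k).mem_nhds hmem] with τ hτ
    exact D.gN_eq_of_mem_piece hτ hk
  rw [timeDerivWithin_univ_congr hev x, D.gN_eq_of_mem_piece hmem hk, D.u_eq_of_mem_piece hmem]
  exact D.transport_G k t x

/-! ## Incompressibility and boundedness of the velocity -/

/-- **The cascade velocity is divergence free.** [cite: DrivasEtAl2022, Theorem 2] -/
theorem isDivFree_u (t : ℝ) : IsDivFree (D.u t) :=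
  isDivFree_drift (D.pj_ne_qj _) _ _

/-- **The cascade velocity is bounded by `2C_ψ`.** [cite: DrivasEtAl2022, Theorem 2] -/
theorem norm_u_le (t : ℝ) (x : UnitAddTorus d) : ‖D.u t x‖ ≤ 2 * ShearCascade.Cψ1 := by
  unfold u U
  refine (norm_drift_le _ _ (fun y => D.abs_prof_le _ _ y) _ x).trans ?_
  rw [mul_one]
  exact D.abs_deriv_A_le _ t

end CascadeData

end DEIJ

end Torus

end Literature.Analysis.FluidPDE
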